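import Summits.QuantumFields.YangMills.Theorems.BalabanUVNodesN11SmallRegFirstStepFails
import Literature.MathematicalPhysics.QuantumFieldTheory.Balaban1983to89.Node00.Record13NumericsOfThm1C

/-!
# DAG node N11 — AT K0a's [15]-KEYED STAGE-13 WITNESS FAMILY `theta13OfThm1C ε₀ ε₂₉ B₃ a₀ a₁` (the (2.12) class at [Balaban1985Variational] Thm 1's `a₀`:
# `εreg := a₀`) the FIRST (S1ᵀ)₁₃ INSTANCE FAILS whenever `a₀` lies in [B7] Prop. 2's range: `¬ TLaw₁₃ F 2 θ₁₅ᶜ p 0` and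
# `¬ (∀ k < K, SLaw₁₃ θ₁₅ᶜ p k → TLaw₁₃ θ₁₅ᶜ p k)` on every run with `0 < K` and small couplings

Cell `pub-ymgap`, YM-PLAN Track A (HUMAN RULING D-0062), seat `pub-ymgap-dag-n11-d` (g5; R134 fan-out seat N11 [B14], strategy s2), item K1⁗ `StabilityBAtRecordR13Sep`
= stmt-QuantumFields-20290.  [III] = [Balaban1988Convergent], [15] = [Balaban1985Variational], [B7] = [Balaban1985Averaging].  Instance of this seat's
`…N11SmallRegFirstStepFails.not_tLaw₁₃_zero_su2_of_hasResidualsOfRecord_of_small_εreg` ∕ `not_s1T₁₃_su2_…` at seat node00-def-K0a's witness family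
`Node00.theta13OfThm1C` (`Record13NumericsOfThm1C`: `εreg := a₀`, `cR = 1`, `M = M₁ = M₂ = 1`, `A₁ = 1`, K0b's residuals of record).

WHAT THIS FILE PROVES (0 `sorry`, 0 `def`, standard axioms).  For every four-torus family `F`, every `(ε₀, ε₂₉, B₃, a₀, a₁)` with `0 < a₀`,
`143·((d+4)²∕4)²·a₀ ≤ ⅓` and `2a₀ ≤ 2δ₂∕((d+4)L)²` ([B7] Prop. 2's range; `d = 4`), and every run `p` with `0 < K` whose generated couplings satisfy the first-step
letters `0 < ε₁η₁²`, `ε₀(g₀) ≤ a₀`, `ε₀(g₀) ≤ a₀η₁²`, `ε₁η₁² + 8δ₀ < 2` (all small-coupling conditions):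
* `three_mul_side_le_sideχ_theta13OfThm1C` — the grid condition `3·L·M₁ ≤ sideχ` holds at the family (`L ≥ 12`, `M₁ = M₂ = 1`, `R₁ ≥ 1`);
* **`not_tLaw₁₃_zero_theta13OfThm1C`** — `¬ TLaw₁₃ F 2 (theta13OfThm1C F 2 ε₀ ε₂₉ B₃ a₀ a₁) p 0`;
* **`not_s1T₁₃_theta13OfThm1C`** — `¬ (∀ k < K, SLaw₁₃ … p k → TLaw₁₃ … p k)`: rung 1's N11 conjunct (S1ᵀ)₁₃ is FALSE at the witness.

READING (count-neutral; nothing of Bałaban asserted or refuted).  The K0-lane's print-faithful re-pin of the regularity threshold to [15]'s `a₀` — the very move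
that makes ROW P11's letter inequalities theorems — puts `εreg` in the range where def-R's (2.12) solution map provably takes its UNIT branch at rough data, so the
typed (S1ᵀ)₁₃ slot of K1⁗'s rung 1 cannot be met at that witness by its N11 entry as typed (`b14_main_of_isRecordOfRecord₁₃CSep_datum_of_liveSel … hT`, hT =
(S1ᵀ)).  The witness of record `theta13LiveOfRecord` (`εreg = 1`) is outside the range (tree-undecidable there).  K1⁗ (∃θ) NOT refuted; N11 NOT discharged;
counts unmoved (typed 28∕28 · discharged 5∕28).  One finite four-torus at fixed `ε = L^{−K}`; NOT ℝ⁴ ∕ OS ∕ mass gap ∕ Clay.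
-/

noncomputable section

open MeasureTheory
open scoped BigOperators Matrix.Norms.L2Operator

namespace Summit.QuantumFields.YangMills.Theorems.BalabanUVNodesN11FirstStepFailsAtThm1CWitness

open Literature.MathematicalPhysics.QuantumFieldTheory.Balaban1983to89 T4Continuum Node00 Node00.Tk DagBinding
open Literature.MathematicalPhysics.QuantumFieldTheory.Balaban1983to89.ExpMeanLog (deltaSU)
open B14.Eq213MaximalDomains (side)
open Summit.QuantumFields.YangMills.Theorems.BalabanUVNodesN11AllLargeFieldLabel (RkOfRecord_pos)
open Summit.QuantumFields.YangMills.Theorems.BalabanUVNodesN11SmallRegFirstStepFails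
  (not_tLaw₁₃_zero_su2_of_hasResidualsOfRecord_of_small_εreg not_s1T₁₃_su2_of_hasResidualsOfRecord_of_small_εreg)

variable (F : T4Family) (ε₀ ε₂₉ B₃ a₀ a₁ : ℝ) (p : B12.RunParams)

/-- **THE GRID CONDITION HOLDS AT THE FAMILY**: `3·L·M₁ ≤ sideχ = L²·M₂·R₁` with `M₁ = M₂ = 1`, `R₁ ≥ 1`, `L ≥ 12`. [cite: Balaban1988Convergent, (2.13) pp.256–257, (2.17) p.257, (3.2) p.265 (bookkeeping)] -/
theorem three_mul_side_le_sideχ_theta13OfThm1C {N : ℕ} [NeZero N] :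
    3 * side (F.P p.K).L (theta13OfThm1C F N ε₀ ε₂₉ B₃ a₀ a₁).ν.M₁ 1 ≤
      sideχ F (theta13OfThm1C F N ε₀ ε₂₉ B₃ a₀ a₁).ν p (gOfRecord₁₃ F N (theta13OfThm1C F N ε₀ ε₂₉ B₃ a₀ a₁) p) 0 := by
  have hL : 12 ≤ (F.P p.K).L := by rw [T4Family.P_L]; exact F.hL11
  have hR := RkOfRecord_pos (F.P p.K).L_pos (theta13OfThm1C F N ε₀ ε₂₉ B₃ a₀ a₁).ν.r
    (gOfRecord₁₃ F N (theta13OfThm1C F N ε₀ ε₂₉ B₃ a₀ a₁) p (0 + 1))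
  show 3 * ((F.P p.K).L ^ 1 * 1) ≤ (F.P p.K).L ^ (0 + 1 + 1) * 1 *
    RkOfRecord (F.P p.K).L (theta13OfThm1C F N ε₀ ε₂₉ B₃ a₀ a₁).ν.r (gOfRecord₁₃ F N (theta13OfThm1C F N ε₀ ε₂₉ B₃ a₀ a₁) p (0 + 1))
  calc 3 * ((F.P p.K).L ^ 1 * 1) = 3 * (F.P p.K).L * 1 := by ring
    _ ≤ (F.P p.K).L * (F.P p.K).L * RkOfRecord (F.P p.K).L (theta13OfThm1C F N ε₀ ε₂₉ B₃ a₀ a₁).ν.r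
          (gOfRecord₁₃ F N (theta13OfThm1C F N ε₀ ε₂₉ B₃ a₀ a₁) p (0 + 1)) :=
        Nat.mul_le_mul (Nat.mul_le_mul_right _ (by omega)) hR
    _ = (F.P p.K).L ^ (0 + 1 + 1) * 1 * RkOfRecord (F.P p.K).L (theta13OfThm1C F N ε₀ ε₂₉ B₃ a₀ a₁).ν.r
          (gOfRecord₁₃ F N (theta13OfThm1C F N ε₀ ε₂₉ B₃ a₀ a₁) p (0 + 1)) := by ring

/-- **`¬ TLaw₁₃` AT THE [15]-KEYED WITNESS** `θ₁₅ᶜ = theta13OfThm1C F 2 ε₀ ε₂₉ B₃ a₀ a₁` for `a₀` in [B7] Prop. 2's range, on every run with `0 < K` meeting the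
first-step letters (`0 < ε₁η₁²`, `ε₀(g₀) ≤ a₀`, `ε₀(g₀) ≤ a₀·η₁²`, `ε₁η₁² + 8δ₀ < 2`).
[cite: Balaban1988Convergent, Theorem p.245, (3.25) p.270, (2.12) p.256, (3.2)–(3.5) p.265; Balaban1985Variational, Thm 1 p.279; Balaban1985Averaging, Prop. 2 (52)–(54) p.26] -/
theorem not_tLaw₁₃_zero_theta13OfThm1C (hK : 0 < p.K) (ha₀ : 0 < a₀)
    (ha3 : (143 * (((((F.P p.K).d + 4 : ℕ) : ℝ)) ^ 2 / 4) ^ 2) * a₀ ≤ 1 / 3)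
    (ha2 : 2 * a₀ ≤ 2 * deltaSU (Fin 2) / ((((F.P p.K).d + 4) * (F.P p.K).L : ℕ) : ℝ) ^ 2)
    (hε₁ : 0 < epsOfRecord (theta13OfThm1C F 2 ε₀ ε₂₉ B₃ a₀ a₁).ν (gOfRecord₁₃ F 2 (theta13OfThm1C F 2 ε₀ ε₂₉ B₃ a₀ a₁) p) 1 * (F.P p.K).eta 1 ^ 2)
    (hc : epsOfRecord (theta13OfThm1C F 2 ε₀ ε₂₉ B₃ a₀ a₁).ν (gOfRecord₁₃ F 2 (theta13OfThm1C F 2 ε₀ ε₂₉ B₃ a₀ a₁) p) 0 ≤ a₀ * (F.P p.K).eta 0 ^ 2)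
    (hαε : epsOfRecord (theta13OfThm1C F 2 ε₀ ε₂₉ B₃ a₀ a₁).ν (gOfRecord₁₃ F 2 (theta13OfThm1C F 2 ε₀ ε₂₉ B₃ a₀ a₁) p) 0 ≤ a₀ * (F.P p.K).eta 1 ^ 2)
    (hδ : epsOfRecord (theta13OfThm1C F 2 ε₀ ε₂₉ B₃ a₀ a₁).ν (gOfRecord₁₃ F 2 (theta13OfThm1C F 2 ε₀ ε₂₉ B₃ a₀ a₁) p) 1 * (F.P p.K).eta 1 ^ 2 +
      4 * (2 * deltaOfRecord (theta13OfThm1C F 2 ε₀ ε₂₉ B₃ a₀ a₁).ν (gOfRecord₁₃ F 2 (theta13OfThm1C F 2 ε₀ ε₂₉ B₃ a₀ a₁) p) 0 1) < 2) :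
    ¬ TLaw₁₃ F 2 (theta13OfThm1C F 2 ε₀ ε₂₉ B₃ a₀ a₁) p 0 :=
  not_tLaw₁₃_zero_su2_of_hasResidualsOfRecord_of_small_εreg _ p (hasResidualsOfRecord_theta13OfThm1C F 2 ε₀ ε₂₉ B₃ a₀ a₁) hK
    (by rw [theta13OfThm1C_τ9_M]) (by rw [theta13OfThm1C_εreg]; exact ha₀) (by rw [theta13OfThm1C_εreg]; exact ha3)
    (by rw [theta13OfThm1C_εreg]; exact ha2) le_rfl le_rfl (three_mul_side_le_sideχ_theta13OfThm1C F ε₀ ε₂₉ B₃ a₀ a₁ p) hε₁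
    (by rw [theta13OfThm1C_cR, one_mul, theta13OfThm1C_εreg]; exact hc) (by rw [theta13OfThm1C_cR, one_mul, theta13OfThm1C_εreg]; exact hαε)
    (by rw [theta13OfThm1C_A₁]; exact hδ)

/-- **RUNG 1's N11 CONJUNCT (S1ᵀ)₁₃ IS FALSE AT THE [15]-KEYED WITNESS** (same hypotheses): `¬ (∀ k < K, SLaw₁₃ θ₁₅ᶜ p k → TLaw₁₃ θ₁₅ᶜ p k)`.
[cite: Balaban1988Convergent, Theorem p.245, Thm 1 p.262, (3.25) p.270; Balaban1985Variational, Thm 1 p.279; Balaban1985Averaging, Prop. 2 (52)–(54) p.26] -/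
theorem not_s1T₁₃_theta13OfThm1C (hK : 0 < p.K) (ha₀ : 0 < a₀)
    (ha3 : (143 * (((((F.P p.K).d + 4 : ℕ) : ℝ)) ^ 2 / 4) ^ 2) * a₀ ≤ 1 / 3)
    (ha2 : 2 * a₀ ≤ 2 * deltaSU (Fin 2) / ((((F.P p.K).d + 4) * (F.P p.K).L : ℕ) : ℝ) ^ 2)
    (hε₁ : 0 < epsOfRecord (theta13OfThm1C F 2 ε₀ ε₂₉ B₃ a₀ a₁).ν (gOfRecord₁₃ F 2 (theta13OfThm1C F 2 ε₀ ε₂₉ B₃ a₀ a₁) p) 1 * (F.P p.K).eta 1 ^ 2)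
    (hc : epsOfRecord (theta13OfThm1C F 2 ε₀ ε₂₉ B₃ a₀ a₁).ν (gOfRecord₁₃ F 2 (theta13OfThm1C F 2 ε₀ ε₂₉ B₃ a₀ a₁) p) 0 ≤ a₀ * (F.P p.K).eta 0 ^ 2)
    (hαε : epsOfRecord (theta13OfThm1C F 2 ε₀ ε₂₉ B₃ a₀ a₁).ν (gOfRecord₁₃ F 2 (theta13OfThm1C F 2 ε₀ ε₂₉ B₃ a₀ a₁) p) 0 ≤ a₀ * (F.P p.K).eta 1 ^ 2)
    (hδ : epsOfRecord (theta13OfThm1C F 2 ε₀ ε₂₉ B₃ a₀ a₁).ν (gOfRecord₁₃ F 2 (theta13OfThm1C F 2 ε₀ ε₂₉ B₃ a₀ a₁) p) 1 * (F.P p.K).eta 1 ^ 2 +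
      4 * (2 * deltaOfRecord (theta13OfThm1C F 2 ε₀ ε₂₉ B₃ a₀ a₁).ν (gOfRecord₁₃ F 2 (theta13OfThm1C F 2 ε₀ ε₂₉ B₃ a₀ a₁) p) 0 1) < 2) :
    ¬ (∀ k, k < p.K → SLaw₁₃ F 2 (theta13OfThm1C F 2 ε₀ ε₂₉ B₃ a₀ a₁) p k → TLaw₁₃ F 2 (theta13OfThm1C F 2 ε₀ ε₂₉ B₃ a₀ a₁) p k) := fun h =>
  not_tLaw₁₃_zero_theta13OfThm1C F ε₀ ε₂₉ B₃ a₀ a₁ p hK ha₀ ha3 ha2 hε₁ hc hαε hδ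
    (h 0 hK (sLaw₁₃_zero F 2 (theta13OfThm1C F 2 ε₀ ε₂₉ B₃ a₀ a₁) p))

end Summit.QuantumFields.YangMills.Theorems.BalabanUVNodesN11FirstStepFailsAtThm1CWitness

end
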